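import Literature.MathematicalPhysics.QuantumFieldTheory.Balaban1983to89.B15Prop1AnalyticExtAtRecord

/-!
# `Balaban1983to89.B15Prop1AnalyticExtPerturbed` — [Balaban1989LargeFieldI] Prop. 1 p. 194, last clause at the record, with the (c3)-shape letter at
# the PERTURBED data derived: the first variation (m5) and the differentiability of print's function at the perturbed datum `exp(ip)·V_k`
# ([Balaban1989LargeFieldII] p. 359 «We expand the function with respect to B′ … the condition for a critical configuration is the equation (1.12)»)

statement-level skeleton of published theorems with citation tags; proofs where landed; nothing here is a claim about
the Yang–Mills mass gap

Cell pub-ymgap, HUMAN RULING D-0062 (Track A full width), seat `pub-ymgap-dag-n12-c` (R134 (a), DAG node N12 = [B15]; generation g4, eleventh product;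
dag-lead REBALANCE №68 (x) follow-up).

WHAT THIS FILE PROVES (no `sorry`, no definition, no `… : Prop` fact; axioms standard).  ★★★
**`exists_domain_prop1Printed_lfVarOn_std_su2_box_analytic'`** = `B15Prop1AnalyticExtAtRecord.exists_domain_prop1Printed_lfVarOn_std_su2_box_analytic`
(p506014) with its letter `hc3p` (criticality of `exp(i·ιA B)·ext(exp(ip)V_k)` ⇔ the real (1.12) with `(H, Δ₁, dV, Jp p)`) NO LONGER A HYPOTHESIS: it is
DERIVED — exactly as (c3) at the base datum (`B15Prop1CriticalAtBoxG0`, `B15Prop1ChartRecentering`) — from the (m5)-shape first-variation letter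
`hAp` and the differentiability letter `hGp` of print's function `B′ ↦ A(U_{k,Z}(exp(iB′)·ext(exp(ip)V_k)))` AT THE PERTURBED DATA, with the same
operators `H, Δ₁, dV` and the current family `Jp p` (r13's reading of the p. 359 proof — *«the field V_k enters (1.13) through the current»* — now
stated as letters about print's function instead of an iff), via `B15Prop1CriticalViaSlice.isCriticalPt_iff_of_hasDerivAt` at print's `G₀`
(`treeOrder_G0`, `tgt_G0_mem`), the Λ-invariance from (181) (`fun177_gaugeAct`) and `B15Prop1ChartRecentering.exists_hasFDerivAt_of_differentiableAt`.

HONEST SCOPE.  Count-neutral; NODE 00's objects displayed, not built; N12 NOT discharged; nothing continuum ∕ OS ∕ mass-gap ∕ Clay.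
-/

noncomputable section

open Set Finset
open scoped BigOperators Matrix RealInnerProductSpace Real InnerProductSpace

namespace Literature.MathematicalPhysics.QuantumFieldTheory.Balaban1983to89.B15Prop1AnalyticExtPerturbed

open B15DeterminingSets GaugeField B16Sect1Backgrounds B15Prop1Carrier B8Eq17ClassAkV1
open B15Prop1CarrierOnSU2Box B15Prop1SliceIneq18 B15Prop1CarrierOnSU2BoxIneq19 B15Prop1CarrierOnSU2BoxExt193 B15Prop1SliceIneq167
open B15Prop1StdInstanceSU2Box B15Prop1LipschitzFromProp4 B15Prop1AdjointOfRecord B15Prop1CriticalViaSlice B15Prop1ChartCalculusSU2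
open B15Prop1CriticalAtBoxG0 B15Prop1ChartRecentering B15Prop1LocalLettersModel B15Prop1LocalLettersSU2Box B15Prop1LocalLettersRecord
open B15Prop1AnalyticExtClause B15Prop1AnalyticExtAtRecord
open T4CubeChartGnomonic (SU2)
open B15Prop1ChartSU2 (su2Chart)
open B15Prop1SliceCoordinates (GaugeSlice ιA freeBonds norm_ιA_apply_le)
open T4AxialGaugeSmallField (castSite boxPlaqs)
open T4AxialGaugeFixing (TreeOrder boxDepth)
open B7Prop1Explicit (e e_apply)
open B6BondElimination (unitVec unitVec_apply)
open B6TreeGaugePoincare (curl)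
open B16Eq18Proof (box mem_box)
open B15Extension193 (extend)
open B15ShellGauge193 (shellGauge)
open B5Prop11Plancherel (Tor)
open B5Bounds167Lattice (formDk ofRealCfg)
open B14.Eq213DetSet B14.Eq216Concrete B14.Eq12InteriorLocality B15Sect1Instances B15Eq177GaugeInvariance
open Literature.MathematicalPhysics.QuantumFieldTheory.BalabanImbrieJaffe1984to88.BIJ85Eq453GaugeField
open B11Prop6Scheme (Prop4Hyp)

section Knit

open Classical

variable {P : Params}

/-- ★★★ **PROPOSITION 1 [IV] AT THE CARRIER OF RECORD, ANALYTIC-EXTENSION CLAUSE TYPED AND DISCHARGED, (c3) AT THE PERTURBED DATA DERIVED.**  See the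
module docstring. [cite: Balaban1989LargeFieldI, Prop. 1 (1.77)–(1.78) p.194, p.193; Balaban1989LargeFieldII, pp.357–359, (1.12)–(1.13); Balaban1985Variational,
Prop. 4 pp.292–293, (181) p.307, (190) p.308] -/
theorem exists_domain_prop1Printed_lfVarOn_std_su2_box_analytic' (hd3 : 3 ≤ P.d) (h0 : 0 < P.d) {ι : Type}
    {av : ∀ j, Averaging P j SU2}
    (bg : DetBackground P SU2 av) (M₁ : ℕ) (Z Λ : ι → Set (Site P 0)) (k : ι → ℕ) (M : ι → ℝ)
    (hk : ∀ i, k i ≤ P.m + P.K)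
    (eR : ι → ℝ) (heR : ∀ i, 0 < eR i)
    (h181 : ∀ i (u : GaugeTransf P (k i) SU2), Cov181 bg (Bj M₁ (Z i) (k i)) (blockLift (k i) u))
    (T : ∀ i, Finset (PBond P (k i)))
    {F : ι → Type*} [∀ i, NormedAddCommGroup (F i)] [∀ i, InnerProductSpace ℝ (F i)] [∀ i, FiniteDimensional ℝ (F i)]
    (H : ∀ i, GaugeField P (k i) SU2 →
      (GaugeSlice (pts (k i) (Λ i)) (T i) (EuclideanSpace ℝ (Fin 3)) →ₗ[ℝ] F i))
    (Δ₁ : ∀ i, GaugeField P (k i) SU2 → (F i →ₗ[ℝ] F i)) (dV : ∀ i, GaugeField P (k i) SU2 → F i → F i)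
    {Fc : ι → Type*} [∀ i, NormedAddCommGroup (Fc i)] [∀ i, InnerProductSpace ℂ (Fc i)] [∀ i, CompleteSpace (Fc i)]
    -- the complexification embedding is now ℝ-LINEAR and TOTALLY REAL (its isometry and `emb 0 = 0` are consequences)
    (emb : ∀ i, F i →ₗ[ℝ] Fc i) (hembI : ∀ i (u v : F i), ⟪emb i u, emb i v⟫_ℂ = ((⟪u, v⟫_ℝ : ℝ) : ℂ))
    (W : ∀ i, GaugeField P (k i) SU2 → Fc i → Fc i) {C₄ a₃ a : ι → ℝ} (hC₄ : ∀ i, 0 ≤ C₄ i) (ha : ∀ i, 0 < a i)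
    (hW : ∀ i Vk, PlaqSmallOn (plaqsInside (pts (k i) (Z i ∩ (Λ i)ᶜ))) (eR i) Vk → Prop4Hyp (W i Vk) (C₄ i) (a₃ i)) (hWdV : ∀ i Vk (u : F i), W i Vk (emb i u) = emb i (dV i Vk u))
    (J : ∀ i, GaugeField P (k i) SU2 → F i)
    (lo hi : ι → Fin P.d → ℤ) (n : ι → ℕ) (hn : ∀ i κ, hi i κ ≤ lo i κ + n i) (hN : ∀ i, n i + 2 < P.sitesPerDir (k i))
    (hbox : ∀ i, pts (k i) (Λ i) = (castSite '' Set.Icc (lo i) (hi i) : Set (Site P (k i))))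
    (hZ : ∀ i, (boxPlaqs (lo i - 1) (hi i + 1) : Set (Plaq P (k i))) ⊆ plaqsInside (pts (k i) (Z i)))
    (hTG0 : ∀ i, T i = (box (fun κ => (hi i κ - lo i κ + 1).toNat) (lo i)).image fun x =>
      (⟨castSite (x - unitVec ⟨0, h0⟩), ⟨0, h0⟩⟩ : PBond P (k i)))
    (hN5 : ∀ i κ, ((hi i κ - lo i κ + 1).toNat : ℤ) + 5 < P.sitesPerDir (k i))
    (K : ι → ℕ) (hK1 : ∀ i, 1 ≤ K i) (hKn : ∀ i κ, (hi i κ - lo i κ + 1).toNat ≤ K i)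
    (ext : ∀ i, GaugeField P (k i) SU2 → GaugeField P (k i) SU2)
    (hext : ∀ i Vk, ext i Vk = extend (pts (k i) (Λ i)) (shellGauge Vk (lo i) (hi i)) Vk)
    (hlohi : ∀ i, lo i ≤ hi i)
    {γ h₁ cJ bx : ℝ} (hγ : 0 < γ) (hh₁ : 0 ≤ h₁) (hcJ : 0 ≤ cJ) (hbx : 0 ≤ bx)
    (hbxM : ∀ i, 12 * (P.d : ℝ) * ((n i : ℝ) + 2) ^ 2 ≤ bx * (M i) ^ 2)
    {ρ r eA Cerr : ι → ℝ} (hr : ∀ i, 0 < r i) (heA : ∀ i, 0 < eA i) (hM : ∀ i, 1 ≤ (M i))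
    (n' : ι → ℕ) (hn' : ∀ i, 1 ≤ n' i)
    (hlead : ∀ i Vk, PlaqSmallOn (plaqsInside (pts (k i) (Z i ∩ (Λ i)ᶜ))) (eR i) Vk → ∀ X : GaugeSlice (pts (k i) (Λ i)) (T i) (EuclideanSpace ℝ (Fin 3)),
      |⟪H i Vk X, Δ₁ i Vk (H i Vk X)⟫ -
          ∑ a : Fin 3, formDk (n' i) (fun _ : Fin P.d => P.sitesPerDir (k i))
            (ofRealCfg (fun _ : Fin P.d => P.sitesPerDir (k i)) fun j =>
              ιA (pts (k i) (Λ i)) (T i) X ⟨j.1, j.2⟩ a)| ≤ Cerr i * ‖X‖ ^ 2)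
    (hsm : ∀ i, Cerr i ≤ (4 / Real.pi ^ 2) ^ (P.d + 2) / (2 * (3 * (K i : ℝ) ^ 2 + 2 * (K i : ℝ) ^ 4)))
    (hγle : ∀ i, γ / (M i) ^ 5 ≤ (4 / Real.pi ^ 2) ^ (P.d + 2) / (2 * (3 * (K i : ℝ) ^ 2 + 2 * (K i : ℝ) ^ 4)))
    (hH : ∀ i Vk, PlaqSmallOn (plaqsInside (pts (k i) (Z i ∩ (Λ i)ᶜ))) (eR i) Vk → ∀ x, ‖H i Vk x‖ ≤ h₁ * ‖x‖)
    (hρ : ∀ i, h₁ * r i ≤ ρ i) (ha₃ : ∀ i, 2 * (ρ i + a i) ≤ a₃ i)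
    (hsmall : ∀ i, (M i) ^ 5 / γ * h₁ * (4 * C₄ i * (ρ i + a i)) * h₁ ≤ 1 / 2)
    (hA : ∀ i Vk, PlaqSmallOn (plaqsInside (pts (k i) (Z i ∩ (Λ i)ᶜ))) (eR i) Vk → ∀ X δ : GaugeSlice (pts (k i) (Λ i)) (T i) (EuclideanSpace ℝ (Fin 3)), ‖X‖ ≤ r i →
      HasDerivAt (fun s : ℝ => (fun177std bg M₁ (Z i) (k i)) (expMul su2Chart (ιA (pts (k i) (Λ i)) (T i) (X + s • δ)) (ext i Vk)))
      (⟪H i Vk δ, J i Vk⟫ + ⟪H i Vk δ, Δ₁ i Vk (H i Vk X)⟫ + ⟪H i Vk δ, dV i Vk (H i Vk X)⟫) 0)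
    (hJ : ∀ i ε Vk, 0 < ε → PlaqSmallOn (plaqsInside (pts (k i) (Z i ∩ (Λ i)ᶜ))) ε Vk → ‖J i Vk‖ ≤ cJ * ε)
    -- (c3) and `hF` DERIVED; the differentiability letter is about print's function of `B′`, at the chart points of the ball
    (hG : ∀ i Vk, PlaqSmallOn (plaqsInside (pts (k i) (Z i ∩ (Λ i)ᶜ))) (eR i) Vk → ∀ B : GaugeSlice (pts (k i) (Λ i)) (T i) (EuclideanSpace ℝ (Fin 3)), ‖B‖ ≤ r i →
      DifferentiableAt ℝ (fun B' : VecField P (k i) (EuclideanSpace ℝ (Fin 3)) =>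
        (fun177std bg M₁ (Z i) (k i)) (expMul su2Chart B' (ext i Vk))) (ιA (pts (k i) (Λ i)) (T i) B))
    (hr2 : ∀ i, r i ≤ 1 / 2)
    -- (x) THE ANALYTIC-EXTENSION CLAUSE DISCHARGED from the complex model at each `eA`-regular datum (`eA ≤ eR`)
    (heAR : ∀ i, eA i ≤ eR i) (hρpos : ∀ i, 0 < ρ i) (hρ3 : ∀ i, h₁ * (3 * r i) ≤ ρ i)
    (Hc : ∀ i, GaugeField P (k i) SU2 → (GaugeSlice (pts (k i) (Λ i)) (T i) (EuclideanSpace ℂ (Fin 3)) →L[ℂ] Fc i))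
    (Hstc : ∀ i, GaugeField P (k i) SU2 → (Fc i →L[ℂ] GaugeSlice (pts (k i) (Λ i)) (T i) (EuclideanSpace ℂ (Fin 3))))
    (hadjc : ∀ i Vk (x : GaugeSlice (pts (k i) (Λ i)) (T i) (EuclideanSpace ℂ (Fin 3))) (y : Fc i), ⟪Hc i Vk x, y⟫_ℂ = ⟪x, Hstc i Vk y⟫_ℂ)
    (Δ₁c : ∀ i, GaugeField P (k i) SU2 → (Fc i →L[ℂ] Fc i))
    (hHc : ∀ i Vk (X : GaugeSlice (pts (k i) (Λ i)) (T i) (EuclideanSpace ℝ (Fin 3))), Hc i Vk (cplxSlice (pts (k i) (Λ i)) (T i) X) = emb i (H i Vk X))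
    (hΔc : ∀ i Vk (u : F i), Δ₁c i Vk (emb i u) = emb i (Δ₁ i Vk u))
    (hposc : ∀ i Vk, PlaqSmallOn (plaqsInside (pts (k i) (Z i ∩ (Λ i)ᶜ))) (eA i) Vk → ∀ x : GaugeSlice (pts (k i) (Λ i)) (T i) (EuclideanSpace ℂ (Fin 3)),
      γ / (M i) ^ 5 * ‖x‖ ^ 2 ≤ RCLike.re ⟪Hc i Vk x, Δ₁c i Vk (Hc i Vk x)⟫_ℂ)
    (hHcn : ∀ i Vk, PlaqSmallOn (plaqsInside (pts (k i) (Z i ∩ (Λ i)ᶜ))) (eA i) Vk → ∀ x : GaugeSlice (pts (k i) (Λ i)) (T i) (EuclideanSpace ℂ (Fin 3)), ‖Hc i Vk x‖ ≤ h₁ * ‖x‖)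
    (hHstcn : ∀ i Vk, PlaqSmallOn (plaqsInside (pts (k i) (Z i ∩ (Λ i)ᶜ))) (eA i) Vk → ∀ z : Fc i, ‖Hstc i Vk z‖ ≤ h₁ * ‖z‖)
    (Jp : ∀ i, GaugeField P (k i) SU2 → VecField P (k i) (EuclideanSpace ℝ (Fin 3)) → F i)
    -- `hc3p` DERIVED: the (m5)-shape first variation and the differentiability letter AT THE PERTURBED DATA (same operators, current `Jp p`)
    (hAp : ∀ i Vk, PlaqSmallOn (plaqsInside (pts (k i) (Z i ∩ (Λ i)ᶜ))) (eA i) Vk → ∀ p : VecField P (k i) (EuclideanSpace ℝ (Fin 3)), ‖p‖ < eA i →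
      ∀ X δ : GaugeSlice (pts (k i) (Λ i)) (T i) (EuclideanSpace ℝ (Fin 3)), ‖X‖ ≤ r i →
        HasDerivAt (fun s : ℝ => (fun177std bg M₁ (Z i) (k i))
          (expMul su2Chart (ιA (pts (k i) (Λ i)) (T i) (X + s • δ)) (ext i (expMul su2Chart p Vk))))
          (⟪H i Vk δ, Jp i Vk p⟫_ℝ + ⟪H i Vk δ, Δ₁ i Vk (H i Vk X)⟫_ℝ + ⟪H i Vk δ, dV i Vk (H i Vk X)⟫_ℝ) 0)
    (hGp : ∀ i Vk, PlaqSmallOn (plaqsInside (pts (k i) (Z i ∩ (Λ i)ᶜ))) (eA i) Vk → ∀ p : VecField P (k i) (EuclideanSpace ℝ (Fin 3)), ‖p‖ < eA i →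
      ∀ B : GaugeSlice (pts (k i) (Λ i)) (T i) (EuclideanSpace ℝ (Fin 3)), ‖B‖ ≤ r i →
        DifferentiableAt ℝ (fun B' : VecField P (k i) (EuclideanSpace ℝ (Fin 3)) =>
          (fun177std bg M₁ (Z i) (k i)) (expMul su2Chart B' (ext i (expMul su2Chart p Vk)))) (ιA (pts (k i) (Λ i)) (T i) B))
    (Jc : ∀ i, GaugeField P (k i) SU2 → VecField P (k i) (EuclideanSpace ℂ (Fin 3)) → Fc i)
    (hJc : ∀ i Vk (p : VecField P (k i) (EuclideanSpace ℝ (Fin 3))), Jc i Vk (cplxVec p) = emb i (Jp i Vk p))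
    (hJcA : ∀ i Vk, PlaqSmallOn (plaqsInside (pts (k i) (Z i ∩ (Λ i)ᶜ))) (eA i) Vk → AnalyticOnNhd ℂ (Jc i Vk) (Metric.ball 0 (eA i)))
    (hJcr : ∀ i Vk, PlaqSmallOn (plaqsInside (pts (k i) (Z i ∩ (Λ i)ᶜ))) (eA i) Vk → ∀ q : VecField P (k i) (EuclideanSpace ℂ (Fin 3)), ‖q‖ < eA i →
      (γ / (M i) ^ 5)⁻¹ * h₁ * ‖Jc i Vk q‖ < r i)
    : ∃ a₁ : ι → ℝ, (∀ i, 0 < a₁ i) ∧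
      B15.Prop1Printed (lfVarOn su2Chart fun i => InstOn.std bg M₁ (Z i) (Λ i) (k i) (M i) (a₁ i)
        (anExt (pts (k i) (Λ i)) (T i) (fun177std bg M₁ (Z i) (k i)) (ext i) (r i))) := by
  refine exists_domain_prop1Printed_lfVarOn_std_su2_box_analytic hd3 h0 bg M₁ Z Λ k M hk eR heR h181 T H Δ₁ dV emb hembI W hC₄ ha hW
    hWdV J lo hi n hn hN hbox hZ hTG0 hN5 K hK1 hKn ext hext hlohi hγ hh₁ hcJ hbx hbxM hr heA hM n' hn' hlead hsm hγle hH hρ ha₃ hsmall hA hJ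
    hG hr2 heAR hρpos hρ3 Hc Hstc hadjc Δ₁c hHc hΔc hposc hHcn hHstcn Jp (fun i Vk hreg p hp B hB => ?_) Jc hJc hJcA hJcr
  -- (c3) at the chart point `exp(i·ιA B)·ext(exp(ip)·V_k)` of the PERTURBED datum, `‖B‖ ≤ r i ≤ 1/2`
  have hNw : ∀ κ, hi i κ - lo i κ + 1 < (P.sitesPerDir (k i) : ℤ) := fun κ => by
    have h5 := hN5 i κ
    have : hi i κ - lo i κ + 1 ≤ ((hi i κ - lo i κ + 1).toNat : ℤ) := Int.self_le_toNat _
    linarith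
  have hT : TreeOrder (T i) PBond.tgt (boxDepth (lo i - e ⟨0, h0⟩) (hi i)) := by
    rw [hTG0 i]; exact treeOrder_G0 h0 hNw
  have hv : ∀ b ∈ T i, b.tgt ∈ pts (k i) (Λ i) := fun b hb => by
    rw [hbox i]; rw [hTG0 i] at hb; exact tgt_G0_mem h0 (lo i) (hi i) b hb
  have hf : ∀ u : GaugeTransf P (k i) SU2, IsGaugeOn (pts (k i) (Λ i)) u →
      ∀ V, fun177std bg M₁ (Z i) (k i) (gaugeAct u V) = fun177std bg M₁ (Z i) (k i) V :=
    fun u _ V => fun177_gaugeAct bg M₁ (hk i) u (h181 i u) V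
  have hX : ∀ b, ‖ιA (pts (k i) (Λ i)) (T i) B b‖ < π := fun b =>
    (norm_ιA_apply_le B b).trans_lt (hB.trans_lt ((hr2 i).trans_lt (by linarith [Real.pi_gt_three])))
  obtain ⟨D, hD⟩ := exists_hasFDerivAt_of_differentiableAt _ (ext i (expMul su2Chart p Vk)) hX (hGp i Vk hreg p hp B hB)
  exact isCriticalPt_iff_of_hasDerivAt hT hv hf (ext i (expMul su2Chart p Vk)) (hB.trans (hr2 i)) hD
    (fun δ => hAp i Vk hreg p hp B δ hB)

end Knit

end Literature.MathematicalPhysics.QuantumFieldTheory.Balaban1983to89.B15Prop1AnalyticExtPerturbed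

end
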